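import Literature.AlgebraicGeometry.Motives.TateTheoremKunnethFullyAlgebraicFactor
import Literature.AlgebraicGeometry.Motives.FullyAlgebraicCohomologyProducts
import HarnessLib

/-!
# All codimensions at once: `T(X × Z) ⟺ T(X)`, `T′`, `S`, Tate's (b) and (a) for `X × Z` iff for `X`,
# along a factor `Z` with fully algebraic cohomology

Topic `Literature/AlgebraicGeometry/Motives`; THEOREMS ONLY (no definition, no instance, no named fact;
D-0026).

Rows g53-#2, #5, #6, #7 compared, codimension by codimension, the Tate classes, the `T′`-form
`K·A = Ker(g − 1)`, the semisimplicity statement `S` (`Ker(g − 1) ∩ (g − 1)H = 0`), hom = num and Tate's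
condition (b) on `X × Z` with those on `X`, for a smooth projective `Z` (dimension `m`) with
`K·A^q(Z) = H^{2q}(Z)` for all `q` and `b_{odd}(Z) = 0`: `Pᶜ(X × Z) ⟺ Pᵖ(X)` for all `p + q = c` with
`H^{2q}(Z) ≠ 0`.  Since `H⁰(Z) ≠ 0` and `H^{2m}(Z) ≠ 0` (`nontrivial_obj_zero`, `nontrivial_obj_top`), the
statements for ALL codimensions match exactly:

* §1 (any field, any `g ∈ Γ_k`) **`(∀ c, Tᶜ(X × Z)) ⟺ (∀ p, Tᵖ(X))`** (`forall_tateConjectureFor_tensor_iff`),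
  the same for `T′` (`forall_algebraicClasses_eq_ker_sub_one_tensor_iff`) and for `S`
  (`forall_ker_inf_range_eq_bot_tensor_iff`); with `D(X × Z) ⟺ D(X)` (row g53-#7):
  **`(∀ c, Tᶜ(X × Z)) ∧ D(X × Z) ⟺ (∀ p, Tᵖ(X)) ∧ D(X)`** (`forall_tateConjectureFor_and_standardConjectureD_tensor_iff`).
* §2 (`k` finite, `g = φ`) **Tate's condition (b) `T′ʳ ∧ T′ˢ ∧ Sʳ` holds for all `r + s = dim` on `X × Z` iff
  on `X`** (`forall_tate_b_tensor_iff`), and likewise **condition (a) `T′ʳ ∧ Eʳ`**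
  (`forall_tate_a_tensor_iff`, through the tree's `(a) ⟺ (b)`, Tate's Th. 2.9); for `Z = 𝐏ʳ`
  (`forall_tateConjectureFor_tensor_projectiveSpace_iff`, `forall_tate_b_tensor_projectiveSpace_iff`).

HC is not touched; `T`, `D` stay open — only equivalences between their instances are proved.

## References

* [Tate1994] J. Tate, *Conjectures on algebraic cycles in ℓ-adic cohomology* (1994), §1 (Conjecture `Tᵖ`),
  §2 Th. 2.9 ((a) ⟺ (b) ⟺ (c)).
* [Milne2007TateFiniteFieldsAIM] J. S. Milne, *The Tate conjecture over finite fields (AIM talk)*,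
  arXiv:0709.3040, §1 Th. 1.2, §2 Cor. 2.2 (`X × 𝐏ʳ`).
* [Milne1986ValuesZetaFunctionsFiniteFields] J. S. Milne, *Values of zeta functions of varieties over finite
  fields* (1986), §8 (`T`, `T′`, `SS`).
* [Kahn2020] B. Kahn, *Zeta and L-Functions of Varieties and Motives* (2020), §6.4 Prop. 6.11–6.12, §6.14 Th. 6.53.
* [Kleiman1968AlgebraicCycles] S. Kleiman, *Algebraic cycles and the Weil conjectures* (1968), §1.2 (A)–(B), §3.
* [Hartshorne1977] R. Hartshorne, *Algebraic Geometry* (1977), App. C Ex. 5.2.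
* Tree: rows g53-#2 (`tateConjectureFor_tensor_iff`), #5 (`ker_inf_range_eq_bot_tensor_iff`), #6
  (`algebraicClasses_eq_ker_sub_one_tensor_iff`, `tate_b_tensor_of_forall`), #7 (`standardConjectureD_tensor_iff`);
  `TateConjectureStrongFormFiniteField` (`tate_a_iff_b`); `WeilCohomology` (`finrank_obj_zero`, `finrank_obj_two_mul`).

## Provenance

Lane `lit-hodgefound` (summit `HodgeConjecture`, Track 2 foundations library, Layer B: motives — Tate's
conjecture for products), seat `lit-hodgefound-p29` (literature-prover, generation 53, row g53-#10).
-/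

universe u v

open CategoryTheory AlgebraicGeometry MonoidalCategory CartesianMonoidalCategory

namespace Literature.AlgebraicGeometry.Motives

namespace WeilCohomology

variable {k : Type u} [Field k] {K : Type v} [Field K] [CharZero K] (W : WeilCohomology k K)
variable {m : ℕ} {Z : SchemeOver k}

/-- `H⁰(Z) ≠ 0` for `Z` smooth projective (`b₀ = 1`). [cite: Kleiman1968AlgebraicCycles, §1.2 (A)] -/
theorem nontrivial_obj_zero (hZ : IsSmoothProjective m Z) : Nontrivial (W.obj Z 0) :=
  Module.nontrivial_of_finrank_eq_succ (W.finrank_obj_zero hZ)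

/-- `H^{2m}(Z) ≠ 0` for `Z` smooth projective of dimension `m` (`b_{2m} = 1`). [cite: Kleiman1968AlgebraicCycles, §1.2 (A)] -/
theorem nontrivial_obj_top (hZ : IsSmoothProjective m Z) : Nontrivial (W.obj Z (2 * m)) :=
  Module.nontrivial_of_finrank_eq_succ (W.finrank_obj_two_mul hZ)

end WeilCohomology

namespace GaloisWeilCohomology

variable {k : Type u} [Field k] {K : Type v} [Field K] [CharZero K]
  {χ : Field.absoluteGaloisGroup k →* Kˣ} (E : GaloisWeilCohomology k K χ)
variable {n m : ℕ} {X Z : SchemeOver k}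

/-! ### §1 `T`, `T′`, `S` in all codimensions -/

/-- **`Tᶜ(X × Z)` for all `c` iff `Tᵖ(X)` for all `p`**, for `Z` with fully algebraic cohomology
(`⟹` through the piece `q = 0`, `H⁰(Z) ≠ 0`). [cite: Tate1994, §1 (Conjecture Tᵖ)] [cite: Milne2007TateFiniteFieldsAIM, Cor. 2.2]
[cite: Kleiman1968AlgebraicCycles, §1.2 (A)–(B)] -/
theorem forall_tateConjectureFor_tensor_iff (hX : IsSmoothProjective n X) (hZ : IsSmoothProjective m Z)
    (hZalg : ∀ q, E.algebraicClasses Z q = ⊤) (hZodd : ∀ j, Odd j → Module.finrank K (E.obj Z j) = 0) :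
    (∀ c, E.TateConjectureFor (X ⊗ Z) c) ↔ ∀ p, E.TateConjectureFor X p := by
  have h0 : Nontrivial (E.obj Z (2 * 0)) := E.nontrivial_obj_zero hZ
  simp only [E.tateConjectureFor_tensor_iff hX hZ hZalg hZodd]
  exact ⟨fun h p ↦ h p p 0 rfl h0, fun h _ p _ _ _ ↦ h p⟩

/-- **`K·Aᶜ(X × Z) = Ker(g − 1)` for all `c` iff `K·Aᵖ(X) = Ker(g − 1)` for all `p`** (the `T′`-form; any
`g ∈ Γ_k`). [cite: Milne1986ValuesZetaFunctionsFiniteFields, §8 T′(X, r, ℓ)] [cite: Tate1994, §2 Th. 2.9] -/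
theorem forall_algebraicClasses_eq_ker_sub_one_tensor_iff (hX : IsSmoothProjective n X)
    (hZ : IsSmoothProjective m Z) (hZalg : ∀ q, E.algebraicClasses Z q = ⊤)
    (hZodd : ∀ j, Odd j → Module.finrank K (E.obj Z j) = 0) (g : Field.absoluteGaloisGroup k) :
    (∀ c, E.algebraicClasses (X ⊗ Z) c = LinearMap.ker (E.ρTwist (X ⊗ Z) (2 * c) c g - 1)) ↔
      ∀ p, E.algebraicClasses X p = LinearMap.ker (E.ρTwist X (2 * p) p g - 1) := by
  have h0 : Nontrivial (E.obj Z (2 * 0)) := E.nontrivial_obj_zero hZ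
  simp only [E.algebraicClasses_eq_ker_sub_one_tensor_iff hX hZ hZalg hZodd g]
  exact ⟨fun h p ↦ h p p 0 rfl h0, fun h _ p _ _ _ ↦ h p⟩

/-- **`Ker(g − 1) ∩ (g − 1)H^{2c}(X × Z)(c) = 0` for all `c` iff `Ker(g − 1) ∩ (g − 1)H^{2p}(X)(p) = 0` for all
`p`** (the statement `S`; any `g ∈ Γ_k`). [cite: Tate1994, §2 Th. 2.9 (b)] [cite: Milne1986ValuesZetaFunctionsFiniteFields, §8 SS(X, r, ℓ)] -/
theorem forall_ker_inf_range_eq_bot_tensor_iff (hX : IsSmoothProjective n X) (hZ : IsSmoothProjective m Z)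
    (hZalg : ∀ q, E.algebraicClasses Z q = ⊤) (hZodd : ∀ j, Odd j → Module.finrank K (E.obj Z j) = 0)
    (g : Field.absoluteGaloisGroup k) :
    (∀ c, LinearMap.ker (E.ρTwist (X ⊗ Z) (2 * c) c g - 1) ⊓
        LinearMap.range (E.ρTwist (X ⊗ Z) (2 * c) c g - 1) = ⊥) ↔
      ∀ p, LinearMap.ker (E.ρTwist X (2 * p) p g - 1) ⊓ LinearMap.range (E.ρTwist X (2 * p) p g - 1) = ⊥ := by
  have h0 : Nontrivial (E.obj Z (2 * 0)) := E.nontrivial_obj_zero hZ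
  simp only [E.ker_inf_range_eq_bot_tensor_iff hX hZ hZalg hZodd g]
  exact ⟨fun h p ↦ h p p 0 rfl h0, fun h _ p _ _ _ ↦ h p⟩

/-- **`T(X × Z) ∧ D(X × Z) ⟺ T(X) ∧ D(X)`** (all codimensions): the Tate conjecture together with hom = num —
the hypothesis of Tate's theorem in form (a) for every codimension — holds for `X × Z` iff it holds for `X`.
[cite: Tate1994, §2 Th. 2.9] [cite: Kahn2020, §6.14 Th. 6.53 and §6.4 Prop. 6.11–6.12] -/
theorem forall_tateConjectureFor_and_standardConjectureD_tensor_iff (hX : IsSmoothProjective n X)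
    (hZ : IsSmoothProjective m Z) (hZalg : ∀ q, E.algebraicClasses Z q = ⊤)
    (hZodd : ∀ j, Odd j → Module.finrank K (E.obj Z j) = 0) :
    (∀ c, E.TateConjectureFor (X ⊗ Z) c) ∧ E.StandardConjectureD (n + m) (X ⊗ Z) ↔
      (∀ p, E.TateConjectureFor X p) ∧ E.StandardConjectureD n X :=
  and_congr (E.forall_tateConjectureFor_tensor_iff hX hZ hZalg hZodd)
    (E.standardConjectureD_tensor_iff hX hZ hZalg hZodd)

/-! ### §2 Finite field: Tate's conditions (b) and (a) in all codimensions -/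

section FiniteField

variable [Finite k]

/-- **Tate's condition (b) `T′ʳ ∧ T′ˢ ∧ Sʳ` for all `r + s = n + m` on `X × Z` iff for all `r + s = n` on
`X`** (`⟸` is row g53-#6's `tate_b_tensor_of_forall`; `⟹` reads the pieces `q = 0` — `H⁰(Z) ≠ 0` — and, for
`T′ˢ`, the piece `q = m` of `T′^{s+m}(X × Z)` — `H^{2m}(Z) ≠ 0`). [cite: Tate1994, §2 Th. 2.9 (b)]
[cite: Milne2007TateFiniteFieldsAIM, Th. 1.2 and Cor. 2.2] [cite: Kahn2020, §6.14 Th. 6.53] -/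
theorem forall_tate_b_tensor_iff (hX : IsSmoothProjective n X) (hZ : IsSmoothProjective m Z)
    (hZalg : ∀ q, E.algebraicClasses Z q = ⊤) (hZodd : ∀ j, Odd j → Module.finrank K (E.obj Z j) = 0) :
    (∀ c c' : ℕ, c + c' = n + m →
      E.algebraicClasses (X ⊗ Z) c = LinearMap.ker (E.ρTwist (X ⊗ Z) (2 * c) c (geomFrob k) - 1) ∧
        E.algebraicClasses (X ⊗ Z) c' = LinearMap.ker (E.ρTwist (X ⊗ Z) (2 * c') c' (geomFrob k) - 1) ∧
        LinearMap.ker (E.ρTwist (X ⊗ Z) (2 * c) c (geomFrob k) - 1) ⊓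
          LinearMap.range (E.ρTwist (X ⊗ Z) (2 * c) c (geomFrob k) - 1) = ⊥) ↔
      ∀ r s : ℕ, r + s = n →
        E.algebraicClasses X r = LinearMap.ker (E.ρTwist X (2 * r) r (geomFrob k) - 1) ∧
          E.algebraicClasses X s = LinearMap.ker (E.ρTwist X (2 * s) s (geomFrob k) - 1) ∧
          LinearMap.ker (E.ρTwist X (2 * r) r (geomFrob k) - 1) ⊓
            LinearMap.range (E.ρTwist X (2 * r) r (geomFrob k) - 1) = ⊥ := by
  refine ⟨fun hb r s hrs ↦ ?_, fun hb c c' _ ↦ E.tate_b_tensor_of_forall hX hZ hZalg hZodd hb c c'⟩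
  have h0 : Nontrivial (E.obj Z (2 * 0)) := E.nontrivial_obj_zero hZ
  have hm : Nontrivial (E.obj Z (2 * m)) := E.nontrivial_obj_top hZ
  obtain ⟨hT, hT', hS⟩ := hb r (s + m) (by omega)
  exact ⟨(E.algebraicClasses_eq_ker_sub_one_tensor_iff hX hZ hZalg hZodd (geomFrob k) r).mp hT r 0 rfl h0,
    (E.algebraicClasses_eq_ker_sub_one_tensor_iff hX hZ hZalg hZodd (geomFrob k) (s + m)).mp hT' s m rfl hm,
    (E.ker_inf_range_eq_bot_tensor_iff hX hZ hZalg hZodd (geomFrob k) r).mp hS r 0 rfl h0⟩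

/-- **Tate's condition (a) `T′ʳ ∧ Eʳ` (hom = num with `ℚ`-classes) for all `r + s = n + m` on `X × Z` iff
for all `r + s = n` on `X`** — through Tate's `(a) ⟺ (b)` on both sides (the tree's `tate_a_iff_b`) and
`forall_tate_b_tensor_iff`. [cite: Tate1994, §2 Th. 2.9] [cite: Milne2007TateFiniteFieldsAIM, Th. 1.2]
[cite: Kahn2020, §6.14 Th. 6.53] -/
theorem forall_tate_a_tensor_iff (hX : IsSmoothProjective n X) (hZ : IsSmoothProjective m Z)
    (hZalg : ∀ q, E.algebraicClasses Z q = ⊤) (hZodd : ∀ j, Odd j → Module.finrank K (E.obj Z j) = 0) :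
    (∀ (c c' : ℕ) (hcc' : c + c' = n + m),
      E.algebraicClasses (X ⊗ Z) c = LinearMap.ker (E.ρTwist (X ⊗ Z) (2 * c) c (geomFrob k) - 1) ∧
        ∀ x ∈ E.ratAlgebraicClasses (X ⊗ Z) c, (∀ y ∈ E.ratAlgebraicClasses (X ⊗ Z) c',
          E.cupPairing (X ⊗ Z) (n + m) (2 * c) (2 * c') (by omega) x y = 0) → x = 0) ↔
      ∀ (r s : ℕ) (hrs : r + s = n),
        E.algebraicClasses X r = LinearMap.ker (E.ρTwist X (2 * r) r (geomFrob k) - 1) ∧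
          ∀ x ∈ E.ratAlgebraicClasses X r, (∀ y ∈ E.ratAlgebraicClasses X s,
            E.cupPairing X n (2 * r) (2 * s) (by omega) x y = 0) → x = 0 := by
  have hXZ := IsSmoothProjective.tensor_holds hX hZ
  constructor
  · intro ha
    have hb := (E.forall_tate_b_tensor_iff hX hZ hZalg hZodd).mp
      fun c c' hcc' ↦ (E.tate_a_iff_b hXZ hcc' (by omega)).mp (ha c c' hcc')
    exact fun r s hrs ↦ (E.tate_a_iff_b hX hrs (by omega)).mpr (hb r s hrs)
  · intro ha
    have hb := (E.forall_tate_b_tensor_iff hX hZ hZalg hZodd).mpr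
      fun r s hrs ↦ (E.tate_a_iff_b hX hrs (by omega)).mp (ha r s hrs)
    exact fun c c' hcc' ↦ (E.tate_a_iff_b hXZ hcc' (by omega)).mpr (hb c c' hcc')

/-! ### `Z = 𝐏ʳ` -/

/-- **`Tᶜ(X × 𝐏ʳ)` for all `c` iff `Tᵖ(X)` for all `p`** (finite field, trace formula, `χ(φ_arith) = q`, RH
for `𝐏ʳ`; row g53-#2 had `⟸`). [cite: Milne2007TateFiniteFieldsAIM, Cor. 2.2] [cite: Tate1994, §1 (Conjecture Tᵖ)]
[cite: Hartshorne1977, App. C Ex. 5.2] -/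
theorem forall_tateConjectureFor_tensor_projectiveSpace_iff (hE : E.HasLefschetzTraceFormula)
    (hχ : ((χ (arithFrob k) : Kˣ) : K) = Nat.card k) {r : ℕ}
    (hRH : E.WeilRiemannHypothesisFor (projectiveSpace r k) r) (hX : IsSmoothProjective n X) :
    (∀ c, E.TateConjectureFor (X ⊗ projectiveSpace r k) c) ↔ ∀ p, E.TateConjectureFor X p :=
  E.forall_tateConjectureFor_tensor_iff hX (isSmoothProjective_projectiveSpace_holds k r)
    (E.algebraicClasses_projectiveSpace_eq_top hE hχ hRH) (fun _ hj ↦ E.finrank_projectiveSpace_of_odd hE hχ hRH hj)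

/-- **Tate's condition (b) in all codimensions on `X × 𝐏ʳ` iff on `X`** (finite field, RH for `𝐏ʳ`).
[cite: Tate1994, §2 Th. 2.9 (b)] [cite: Milne2007TateFiniteFieldsAIM, Th. 1.2 and Cor. 2.2] [cite: Hartshorne1977, App. C Ex. 5.2] -/
theorem forall_tate_b_tensor_projectiveSpace_iff (hE : E.HasLefschetzTraceFormula)
    (hχ : ((χ (arithFrob k) : Kˣ) : K) = Nat.card k) {r : ℕ}
    (hRH : E.WeilRiemannHypothesisFor (projectiveSpace r k) r) (hX : IsSmoothProjective n X) :
    (∀ c c' : ℕ, c + c' = n + r →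
      E.algebraicClasses (X ⊗ projectiveSpace r k) c =
          LinearMap.ker (E.ρTwist (X ⊗ projectiveSpace r k) (2 * c) c (geomFrob k) - 1) ∧
        E.algebraicClasses (X ⊗ projectiveSpace r k) c' =
          LinearMap.ker (E.ρTwist (X ⊗ projectiveSpace r k) (2 * c') c' (geomFrob k) - 1) ∧
        LinearMap.ker (E.ρTwist (X ⊗ projectiveSpace r k) (2 * c) c (geomFrob k) - 1) ⊓
          LinearMap.range (E.ρTwist (X ⊗ projectiveSpace r k) (2 * c) c (geomFrob k) - 1) = ⊥) ↔
      ∀ a s : ℕ, a + s = n →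
        E.algebraicClasses X a = LinearMap.ker (E.ρTwist X (2 * a) a (geomFrob k) - 1) ∧
          E.algebraicClasses X s = LinearMap.ker (E.ρTwist X (2 * s) s (geomFrob k) - 1) ∧
          LinearMap.ker (E.ρTwist X (2 * a) a (geomFrob k) - 1) ⊓
            LinearMap.range (E.ρTwist X (2 * a) a (geomFrob k) - 1) = ⊥ :=
  E.forall_tate_b_tensor_iff hX (isSmoothProjective_projectiveSpace_holds k r)
    (E.algebraicClasses_projectiveSpace_eq_top hE hχ hRH) (fun _ hj ↦ E.finrank_projectiveSpace_of_odd hE hχ hRH hj)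

end FiniteField

end GaloisWeilCohomology

end Literature.AlgebraicGeometry.Motives
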